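import Mathlib
import HarnessLib
import Summits.HubbardSuperconductivity.HubbardSuperconductivity.Theorems.KLProgrammeKLRegimeFatMultiplierIncrementSampled
import Summits.HubbardSuperconductivity.HubbardSuperconductivity.Theorems.KLProgrammeKLRegimeFatMultiplierIncrementLineChainLocal

/-!
# Route `KLProgramme` — crux K3 ENGINE (stmt-…-20437) stub (b) conj. 2 «(c-D)² FAMILY TELESCOPE», bricks (L1)+(L3) of F1-DESIGN §9 «ANISO-LOC»:
# the SAMPLED INCREMENT SYMBOL `Φ = [Gₙ(k₀²+(e−ν)²) − Gₙ(k₀²+e²)]·Q` with the band's line jets LOCALISED to a cell `C` off which the co-factor vanishes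

Cell `gate-hubbard-kl`, seat hubbard-kl-k3c3-p2 (g10).  Twin of p582397 `norm_fwdDiff_iter_space_incrSymbol_le` for the TANGENT direction of a sector: there the
slope datum `E₁` is the tangency datum, valid only on the sector's cell `C ⊆ (Fin 2 → ℝ)`; the co-factor `Q` (second radial factor × angular factor) has all
its line jets vanishing off `C`, so the Leibniz terms need the increment's jets only on `C`.

* `abs_iteratedDeriv_mul_le_of_local'` — Leibniz to order three with `f`-bounds on `S ∧ B ∧ C`, `g`-bounds on `S ∧ B`, `f`-jets vanishing off `B`, `g`-jets vanishing off `C`;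
* **`norm_fwdDiff_iter_space_incrSymbol_le_local`** — p582397 with `hE_k : ∀ p₀ s, C (p₀ + s•w) → …` and `hQfar : ¬ C (p₀ + s•w) ⇒` the line jets of `Q(k₀, ·)` vanish at `s`;
  same constants `𝔅_k`, same conclusion.

Everything is proved; no definitions, no sorry.  Nothing asserts superconductivity. [cite: BenfattoGiulianiMastropietro2006, §2.5 Lemma 2.2 (2.53)–(2.55), §3 (3.2)]
-/

noncomputable section

namespace Summit.HubbardSuperconductivity.HubbardSuperconductivity.Theorems.TorusFourierL2

set_option linter.dupNamespace false -- summit = problem name (single-conjunct summit), D-0017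

open Set Finset Filter Topology Literature.MathematicalPhysics.QuantumLattice Literature.MathematicalPhysics.QuantumLattice.FermiRG
open Literature.Probability.LatticeModels Literature.Analysis.Calculus
open Summit.HubbardSuperconductivity.HubbardSuperconductivity.Theorems.KLRegimeSplit
open Summit.HubbardSuperconductivity.HubbardSuperconductivity.Theorems.KLProgrammeLegKernels
open scoped Real

/-! ### §1 Leibniz with both factors localised -/

/-- **Leibniz with both factors localised**: `f, g : ℝ → ℝ` of class `C³`; `|f^{(k)}| ≤ b_k` at the points of `S ∧ B ∧ C`; `|g^{(k)}| ≤ q_k` at the points of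
`S ∧ B`; every jet of `f` vanishes off `B`, every jet of `g` vanishes off `C`.  Then at every point of `S`:
`|(fg)′| ≤ b₁q₀ + b₀q₁`, `|(fg)″| ≤ b₂q₀ + 2b₁q₁ + b₀q₂`, `|(fg)‴| ≤ b₃q₀ + 3b₂q₁ + 3b₁q₂ + b₀q₃`. [cite: BenfattoGiulianiMastropietro2006, §2.5 (2.55)] -/
theorem abs_iteratedDeriv_mul_le_of_local' {f g : ℝ → ℝ} (hf : ContDiff ℝ 3 f) (hg : ContDiff ℝ 3 g) (S B C : ℝ → Prop)
    {b₀ b₁ b₂ b₃ q₀ q₁ q₂ q₃ : ℝ} (hb₀ : 0 ≤ b₀) (hb₁ : 0 ≤ b₁) (hb₂ : 0 ≤ b₂) (hb₃ : 0 ≤ b₃) (hq₀ : 0 ≤ q₀) (hq₁ : 0 ≤ q₁) (hq₂ : 0 ≤ q₂) (hq₃ : 0 ≤ q₃)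
    (hf0 : ∀ s, S s → B s → C s → |f s| ≤ b₀) (hf1 : ∀ s, S s → B s → C s → |iteratedDeriv 1 f s| ≤ b₁)
    (hf2 : ∀ s, S s → B s → C s → |iteratedDeriv 2 f s| ≤ b₂) (hf3 : ∀ s, S s → B s → C s → |iteratedDeriv 3 f s| ≤ b₃)
    (hg0 : ∀ s, S s → B s → |g s| ≤ q₀) (hg1 : ∀ s, S s → B s → |iteratedDeriv 1 g s| ≤ q₁) (hg2 : ∀ s, S s → B s → |iteratedDeriv 2 g s| ≤ q₂)
    (hg3 : ∀ s, S s → B s → |iteratedDeriv 3 g s| ≤ q₃)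
    (hfar : ∀ s, ¬ B s → ∀ k ≤ 3, iteratedDeriv k f s = 0) (hgfar : ∀ s, ¬ C s → ∀ k ≤ 3, iteratedDeriv k g s = 0) (s : ℝ) (hs : S s) :
    |iteratedDeriv 1 (fun s => f s * g s) s| ≤ b₁ * q₀ + b₀ * q₁ ∧
    |iteratedDeriv 2 (fun s => f s * g s) s| ≤ b₂ * q₀ + 2 * (b₁ * q₁) + b₀ * q₂ ∧
    |iteratedDeriv 3 (fun s => f s * g s) s| ≤ b₃ * q₀ + 3 * (b₂ * q₁) + 3 * (b₁ * q₂) + b₀ * q₃ := by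
  -- Leibniz (Mathlib, Fréchet form) rewritten with `iteratedDeriv`
  have leib : ∀ n ≤ 3, |iteratedDeriv n (fun s => f s * g s) s| ≤
      ∑ i ∈ Finset.range (n + 1), (n.choose i : ℝ) * |iteratedDeriv i f s| * |iteratedDeriv (n - i) g s| := by
    intro n hn
    have h := norm_iteratedFDeriv_mul_le (𝕜 := ℝ) (A := ℝ) hf hg s (n := n) (by exact_mod_cast hn)
    rw [norm_iteratedFDeriv_eq_norm_iteratedDeriv, Real.norm_eq_abs] at h
    refine h.trans (le_of_eq ?_)
    refine Finset.sum_congr rfl fun i _ => ?_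
    rw [norm_iteratedFDeriv_eq_norm_iteratedDeriv, norm_iteratedFDeriv_eq_norm_iteratedDeriv, Real.norm_eq_abs, Real.norm_eq_abs]
  by_cases hBC : B s ∧ C s
  · obtain ⟨hB, hCs⟩ := hBC
    have g0 := hg0 s hs hB; have g1 := hg1 s hs hB; have g2 := hg2 s hs hB; have g3 := hg3 s hs hB
    have f0 : |iteratedDeriv 0 f s| ≤ b₀ := by rw [iteratedDeriv_zero]; exact hf0 s hs hB hCs
    have g0' : |iteratedDeriv 0 g s| ≤ q₀ := by rw [iteratedDeriv_zero]; exact g0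
    have f1 := hf1 s hs hB hCs; have f2 := hf2 s hs hB hCs; have f3 := hf3 s hs hB hCs
    have m : ∀ {x y X Y : ℝ}, |x| ≤ X → |y| ≤ Y → 0 ≤ X → |x| * |y| ≤ X * Y :=
      fun hx hy hX => mul_le_mul hx hy (abs_nonneg _) hX
    refine ⟨(leib 1 (by norm_num)).trans ?_, (leib 2 (by norm_num)).trans ?_, (leib 3 le_rfl).trans ?_⟩
    · simp only [Finset.sum_range_succ, Finset.sum_range_zero, zero_add, Nat.choose_zero_right, Nat.choose_self, Nat.cast_one, one_mul,
        Nat.sub_zero, Nat.sub_self]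
      have t0 := m f0 g1 hb₀; have t1 := m f1 g0' hb₁
      nlinarith [t0, t1]
    · simp only [Finset.sum_range_succ, Finset.sum_range_zero, zero_add, Nat.choose_zero_right, Nat.choose_self, Nat.cast_one, one_mul,
        Nat.sub_zero, Nat.sub_self, show Nat.choose 2 1 = 2 by rfl, show (2 : ℕ) - 1 = 1 by rfl, Nat.cast_ofNat]
      have t0 := m f0 g2 hb₀; have t1 := m f1 g1 hb₁; have t2 := m f2 g0' hb₂
      nlinarith [t0, t1, t2]
    · simp only [Finset.sum_range_succ, Finset.sum_range_zero, zero_add, Nat.choose_zero_right, Nat.choose_self, Nat.cast_one, one_mul,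
        Nat.sub_zero, Nat.sub_self, show Nat.choose 3 1 = 3 by rfl, show Nat.choose 3 2 = 3 by rfl, show (3 : ℕ) - 1 = 2 by rfl,
        show (3 : ℕ) - 2 = 1 by rfl, Nat.cast_ofNat]
      have t0 := m f0 g3 hb₀; have t1 := m f1 g2 hb₁; have t2 := m f2 g1 hb₂; have t3 := m f3 g0' hb₃
      nlinarith [t0, t1, t2, t3]
  · -- off `B` every jet of `f` vanishes, off `C` every jet of `g` vanishes; either way every derivative of the product vanishes
    have hz : ∀ n ≤ 3, iteratedDeriv n (fun s => f s * g s) s = 0 := by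
      intro n hn
      have h := leib n hn
      have hsum : ∑ i ∈ Finset.range (n + 1), (n.choose i : ℝ) * |iteratedDeriv i f s| * |iteratedDeriv (n - i) g s| = 0 := by
        refine Finset.sum_eq_zero fun i hi => ?_
        have hi' : i ≤ 3 := by have := Finset.mem_range.1 hi; omega
        have hni : n - i ≤ 3 := by omega
        rcases not_and_or.1 hBC with hB | hC
        · rw [hfar s hB i hi', abs_zero, mul_zero, zero_mul]
        · rw [hgfar s hC (n - i) hni, abs_zero, mul_zero]
      rw [hsum] at h
      exact abs_eq_zero.1 (le_antisymm h (abs_nonneg _))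
    rw [hz 1 (by norm_num), hz 2 (by norm_num), hz 3 le_rfl, abs_zero]
    exact ⟨by positivity, by positivity, by positivity⟩

/-! ### §2 The sampled increment symbol with cell-localised band data -/

section SampledLocal

variable {M L : ℕ} [NeZero M] [NeZero L]

set_option maxHeartbeats 1600000 in
/-- **Space differences of the sampled increment symbol, band jets localised to the cell `C`** (twin of `norm_fwdDiff_iter_space_incrSymbol_le`; see the module docstring).  Data: `Λ = klScale e₀ n`, `E₀ = Λ + P₀`, `C_k = d e₀^{2k}/Λ^{2k}`,
`D₁ = 2E₀E₁`, `D₂ = 2(E₁² + E₀E₂)`, `D₃ = 2(3E₁E₂ + E₀E₃)`, `W₀ = P₀(2E₀+P₀)`, `W₁ = 2(E₁P₀+E₀P₁+P₀P₁)`, `W₂ = 2(E₂P₀+2E₁P₁+E₀P₂+P₁²+P₀P₂)`,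
`W₃ = 2(E₃P₀+3E₂P₁+3E₁P₂+E₀P₃+3P₁P₂+P₀P₃)`, `𝔅₀ = C₁W₀`, `𝔅₁ = C₂W₀(D₁+W₁)+C₁W₁`, `𝔅₂ = C₃W₀(D₁+W₁)²+C₂W₁(2D₁+W₁)+C₂W₀(D₂+W₂)+C₁W₂`,
`𝔅₃ = C₄W₀(D₁+W₁)³+C₃W₁(3D₁²+3D₁W₁+W₁²)+3(C₃W₀(D₁+W₁)(D₂+W₂)+C₂(D₁W₂+W₁D₂+W₁W₂))+C₂W₀(D₃+W₃)+C₁W₃`.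
[cite: BenfattoGiulianiMastropietro2006, §2.5 Lemma 2.2 (2.53)–(2.55), §3 (3.2)] -/
theorem norm_fwdDiff_iter_space_incrSymbol_le_local {e₀ : ℝ} (he : 0 < e₀) (n : ℕ) {d : ℝ} (hd1 : ∀ u, |deriv (bgmCutoffSq e₀) u| ≤ d)
    (hd2 : ∀ u, |iteratedDeriv 2 (bgmCutoffSq e₀) u| ≤ d) (hd3 : ∀ u, |iteratedDeriv 3 (bgmCutoffSq e₀) u| ≤ d)
    (hd4 : ∀ u, |iteratedDeriv 4 (bgmCutoffSq e₀) u| ≤ d)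
    {e ν : (Fin 2 → ℝ) → ℝ} (hes : ContDiff ℝ 3 e) (hνs : ContDiff ℝ 3 ν) (w : Fin 2 → ℝ)
    (C : (Fin 2 → ℝ) → Prop) {E₁ E₂ E₃ P₀ P₁ P₂ P₃ : ℝ} (hE10 : 0 ≤ E₁) (hE20 : 0 ≤ E₂) (hE30 : 0 ≤ E₃)
    (hE₁ : ∀ (p₀ : Fin 2 → ℝ) (s : ℝ), C (p₀ + s • w) → |deriv (fun s : ℝ => e (p₀ + s • w)) s| ≤ E₁)
    (hE₂ : ∀ (p₀ : Fin 2 → ℝ) (s : ℝ), C (p₀ + s • w) → |iteratedDeriv 2 (fun s : ℝ => e (p₀ + s • w)) s| ≤ E₂)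
    (hE₃ : ∀ (p₀ : Fin 2 → ℝ) (s : ℝ), C (p₀ + s • w) → |iteratedDeriv 3 (fun s : ℝ => e (p₀ + s • w)) s| ≤ E₃)
    (hP₀ : ∀ p, |ν p| ≤ P₀) (hP₁ : ∀ (p₀ : Fin 2 → ℝ) (s : ℝ), |deriv (fun s : ℝ => ν (p₀ + s • w)) s| ≤ P₁)
    (hP₂ : ∀ (p₀ : Fin 2 → ℝ) (s : ℝ), |iteratedDeriv 2 (fun s : ℝ => ν (p₀ + s • w)) s| ≤ P₂)
    (hP₃ : ∀ (p₀ : Fin 2 → ℝ) (s : ℝ), |iteratedDeriv 3 (fun s : ℝ => ν (p₀ + s • w)) s| ≤ P₃)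
    -- the co-factor
    (Q : ℝ × (Fin 2 → ℝ) → ℝ) (hQ : ∀ (k₀ : ℝ) (p₀ : Fin 2 → ℝ), ContDiff ℝ 3 (fun s : ℝ => Q (k₀, p₀ + s • w)))
    (hQfar : ∀ (k₀ : ℝ) (p₀ : Fin 2 → ℝ) (s : ℝ), ¬ C (p₀ + s • w) → ∀ j ≤ 3, iteratedDeriv j (fun s : ℝ => Q (k₀, p₀ + s • w)) s = 0)
    {q₀ q₁ q₂ q₃ zm : ℝ} (hq₀0 : 0 ≤ q₀) (hq₁0 : 0 ≤ q₁) (hq₂0 : 0 ≤ q₂) (hq₃0 : 0 ≤ q₃) (hq₀ : ∀ k₀ p, |Q (k₀, p)| ≤ q₀)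
    (hq₁ : ∀ (k₀ : ℝ) (p₀ : Fin 2 → ℝ) (s : ℝ), (∀ i, |(p₀ + s • w) i| ≤ π + zm) → |e (p₀ + s • w)| ≤ klScale e₀ n + P₀ →
      |deriv (fun s : ℝ => Q (k₀, p₀ + s • w)) s| ≤ q₁)
    (hq₂ : ∀ (k₀ : ℝ) (p₀ : Fin 2 → ℝ) (s : ℝ), (∀ i, |(p₀ + s • w) i| ≤ π + zm) → |e (p₀ + s • w)| ≤ klScale e₀ n + P₀ →
      |iteratedDeriv 2 (fun s : ℝ => Q (k₀, p₀ + s • w)) s| ≤ q₂)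
    (hq₃ : ∀ (k₀ : ℝ) (p₀ : Fin 2 → ℝ) (s : ℝ), (∀ i, |(p₀ + s • w) i| ≤ π + zm) → |e (p₀ + s • w)| ≤ klScale e₀ n + P₀ →
      |iteratedDeriv 3 (fun s : ℝ => Q (k₀, p₀ + s • w)) s| ≤ q₃)
    -- the symbol and its samples
    (Φ : ℝ × (Fin 2 → ℝ) → ℂ)
    (hΦ : ∀ k₀ p, Φ (k₀, p) = (((bgmCutoffSq e₀ ((16 : ℝ) ^ n * (k₀ ^ 2 + (e p - ν p) ^ 2)) -
      bgmCutoffSq e₀ ((16 : ℝ) ^ n * (k₀ ^ 2 + e p ^ 2))) * Q (k₀, p) : ℝ) : ℂ))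
    (a₀ h₀ hx : ℝ) (u : Fin 2 → ℤ) (hw : w = fun j => hx * (u j : ℝ)) (hu : ∀ j, 3 * |hx| * |(u j : ℝ)| ≤ zm)
    (hzoneΦ : ∀ (k₀ : ℝ) (p : Fin 2 → ℝ), (∃ j, π - zm ≤ |p j|) → Φ (k₀, p) = 0) (hxL : |hx| * L = 2 * π)
    (Gs : TorusSite 1 (2 * M) × TorusSite 2 L → ℂ)
    (hGs : ∀ q, Gs q = Φ (a₀ + h₀ * (((q.1 0).val : ℕ) : ℝ), fun j => hx * (((q.2 j).valMinAbs : ℤ) : ℝ)))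
    -- the constants (instantiate with `rfl`)
    {E₀ C₁ C₂ C₃ C₄ D₁ D₂ D₃ W₀ W₁ W₂ W₃ B₀ B₁ B₂ B₃ : ℝ} (hE₀ : E₀ = klScale e₀ n + P₀)
    (hC₁ : C₁ = d * e₀ ^ 2 / klScale e₀ n ^ 2) (hC₂ : C₂ = d * e₀ ^ 4 / klScale e₀ n ^ 4) (hC₃ : C₃ = d * e₀ ^ 6 / klScale e₀ n ^ 6)
    (hC₄ : C₄ = d * e₀ ^ 8 / klScale e₀ n ^ 8)
    (hD₁ : D₁ = 2 * E₀ * E₁) (hD₂ : D₂ = 2 * (E₁ ^ 2 + E₀ * E₂)) (hD₃ : D₃ = 2 * (3 * E₁ * E₂ + E₀ * E₃))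
    (hW₀ : W₀ = P₀ * (2 * E₀ + P₀)) (hW₁ : W₁ = 2 * (E₁ * P₀ + E₀ * P₁ + P₀ * P₁))
    (hW₂ : W₂ = 2 * (E₂ * P₀ + 2 * E₁ * P₁ + E₀ * P₂ + P₁ ^ 2 + P₀ * P₂))
    (hW₃ : W₃ = 2 * (E₃ * P₀ + 3 * E₂ * P₁ + 3 * E₁ * P₂ + E₀ * P₃ + 3 * P₁ * P₂ + P₀ * P₃))
    (hB₀ : B₀ = C₁ * W₀) (hB₁ : B₁ = C₂ * W₀ * (D₁ + W₁) + C₁ * W₁)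
    (hB₂ : B₂ = C₃ * W₀ * (D₁ + W₁) ^ 2 + C₂ * (W₁ * (2 * D₁ + W₁)) + (C₂ * W₀ * (D₂ + W₂) + C₁ * W₂))
    (hB₃ : B₃ = C₄ * W₀ * (D₁ + W₁) ^ 3 + C₃ * (W₁ * (3 * D₁ ^ 2 + 3 * D₁ * W₁ + W₁ ^ 2)) +
        3 * (C₃ * W₀ * ((D₁ + W₁) * (D₂ + W₂)) + C₂ * (D₁ * W₂ + W₁ * D₂ + W₁ * W₂)) + (C₂ * W₀ * (D₃ + W₃) + C₁ * W₃))
    (q : TorusSite 1 (2 * M) × TorusSite 2 L) :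
    ‖(fwdDiff ((0 : TorusSite 1 (2 * M)), (fun j => ((u j : ℤ) : ZMod L)))) Gs q‖ ≤ B₁ * q₀ + B₀ * q₁ ∧
    ‖((fwdDiff ((0 : TorusSite 1 (2 * M)), (fun j => ((u j : ℤ) : ZMod L))))^[2] Gs) q‖ ≤ B₂ * q₀ + 2 * (B₁ * q₁) + B₀ * q₂ ∧
    ‖((fwdDiff ((0 : TorusSite 1 (2 * M)), (fun j => ((u j : ℤ) : ZMod L))))^[3] Gs) q‖ ≤ B₃ * q₀ + 3 * (B₂ * q₁) + 3 * (B₁ * q₂) + B₀ * q₃ := by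
  have hΛ : 0 < klScale e₀ n := by rw [klScale]; positivity
  have hP0 : 0 ≤ P₀ := (abs_nonneg _).trans (hP₀ 0)
  -- the sample point and the line
  set k₀ : ℝ := a₀ + h₀ * (((q.1 0).val : ℕ) : ℝ) with hk₀
  set k : Fin 2 → ℝ := fun j => hx * (((q.2 j).valMinAbs : ℤ) : ℝ) with hk
  set G : ℝ → ℝ := fun u => bgmCutoffSq e₀ ((16 : ℝ) ^ n * u) with hGdef
  set el : ℝ → ℝ := fun s => e (k + s • w) with hel
  set νl : ℝ → ℝ := fun s => ν (k + s • w) with hνl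
  have helC : ContDiff ℝ 3 el := contDiff_three_line hes k w
  have hνlC : ContDiff ℝ 3 νl := contDiff_three_line hνs k w
  -- the line chains of `e` and `ν`
  have hlinkR : ∀ {f : ℝ → ℝ}, ContDiff ℝ 3 f → ∀ j < 3, ∀ s, HasDerivAt (iteratedDeriv j f) (iteratedDeriv (j + 1) f s) s := by
    intro f hf j hj s
    have hdiff : Differentiable ℝ (iteratedDeriv j f) := hf.differentiable_iteratedDeriv j (by exact_mod_cast hj)
    have h := (hdiff s).hasDerivAt
    rwa [← iteratedDeriv_succ] at h
  have he0 : ∀ s, HasDerivAt el (iteratedDeriv 1 el s) s := fun s => by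
    have h := hlinkR helC 0 (by norm_num) s; rwa [iteratedDeriv_zero] at h
  have he1 : ∀ s, HasDerivAt (iteratedDeriv 1 el) (iteratedDeriv 2 el s) s := fun s => hlinkR helC 1 (by norm_num) s
  have he2 : ∀ s, HasDerivAt (iteratedDeriv 2 el) (iteratedDeriv 3 el s) s := fun s => hlinkR helC 2 (by norm_num) s
  have hν0 : ∀ s, HasDerivAt νl (iteratedDeriv 1 νl s) s := fun s => by
    have h := hlinkR hνlC 0 (by norm_num) s; rwa [iteratedDeriv_zero] at h
  have hν1 : ∀ s, HasDerivAt (iteratedDeriv 1 νl) (iteratedDeriv 2 νl s) s := fun s => hlinkR hνlC 1 (by norm_num) s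
  have hν2 : ∀ s, HasDerivAt (iteratedDeriv 2 νl) (iteratedDeriv 3 νl s) s := fun s => hlinkR hνlC 2 (by norm_num) s
  have bE₁ : ∀ s, C (k + s • w) → |iteratedDeriv 1 el s| ≤ E₁ := fun s hs => by rw [iteratedDeriv_one]; exact hE₁ k s hs
  have bE₂ : ∀ s, C (k + s • w) → |iteratedDeriv 2 el s| ≤ E₂ := fun s hs => hE₂ k s hs
  have bE₃ : ∀ s, C (k + s • w) → |iteratedDeriv 3 el s| ≤ E₃ := fun s hs => hE₃ k s hs
  have bP₀ : ∀ s, |νl s| ≤ P₀ := fun s => hP₀ _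
  have bP₁ : ∀ s, |iteratedDeriv 1 νl s| ≤ P₁ := fun s => by rw [iteratedDeriv_one]; exact hP₁ k s
  have bP₂ : ∀ s, |iteratedDeriv 2 νl s| ≤ P₂ := fun s => hP₂ k s
  have bP₃ : ∀ s, |iteratedDeriv 3 νl s| ≤ P₃ := fun s => hP₃ k s
  -- the increment along the line: complex chain with bounds
  obtain ⟨I₁, I₂, I₃, c0, c1, c2, b0, b1, b2, b3⟩ := profileIncr_hasDerivAt_chain_bounds_local he n hd1 hd2 hd3 hd4 k₀ he0 he1 he2 hν0 hν1 hν2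
    (fun s => C (k + s • w)) hE10 hE20 hE30 bE₁ bE₂ bE₃ bP₀ bP₁ bP₂ bP₃ hE₀ hC₁ hC₂ hC₃ hC₄ hD₁ hD₂ hD₃ hW₀ hW₁ hW₂ hW₃
  -- its real form
  set Ir : ℝ → ℝ := fun s => G (k₀ ^ 2 + (el s - νl s) ^ 2) - G (k₀ ^ 2 + el s ^ 2) with hIr
  have hGC : ContDiff ℝ 3 G := (contDiff_bgmCutoffSq he).comp (contDiff_const.mul contDiff_id)
  have hIrC : ContDiff ℝ 3 Ir :=
    (hGC.comp (contDiff_const.add ((helC.sub hνlC).pow 2))).sub (hGC.comp (contDiff_const.add (helC.pow 2)))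
  have hIc : (fun s => ((bgmCutoffSq e₀ ((16 : ℝ) ^ n * (k₀ ^ 2 + (el s - νl s) ^ 2)) : ℝ) : ℂ) -
      ((bgmCutoffSq e₀ ((16 : ℝ) ^ n * (k₀ ^ 2 + el s ^ 2)) : ℝ) : ℂ)) = fun s => ((Ir s : ℝ) : ℂ) := by
    funext s; simp only [hIr, hGdef]; push_cast; ring
  rw [hIc] at c0
  obtain ⟨d1, d2, d3⟩ := iteratedDeriv_eq_of_hasDerivAt_chain₃ c0 c1 c2
  have rI0 : ∀ s, |Ir s| ≤ B₀ := fun s => by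
    have h := b0 s
    have e1 : ((bgmCutoffSq e₀ ((16 : ℝ) ^ n * (k₀ ^ 2 + (el s - νl s) ^ 2)) : ℝ) : ℂ) -
        ((bgmCutoffSq e₀ ((16 : ℝ) ^ n * (k₀ ^ 2 + el s ^ 2)) : ℝ) : ℂ) = ((Ir s : ℝ) : ℂ) := by
      simp only [hIr, hGdef]; push_cast; ring
    rw [e1, Complex.norm_real, Real.norm_eq_abs, ← hB₀] at h; exact h
  have rI1 : ∀ s, C (k + s • w) → |iteratedDeriv 1 Ir s| ≤ B₁ := fun s hs => by
    rw [← norm_iteratedDeriv_ofReal_comp (hIrC.of_le (by norm_num)) s, d1, hB₁]; exact b1 s hs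
  have rI2 : ∀ s, C (k + s • w) → |iteratedDeriv 2 Ir s| ≤ B₂ := fun s hs => by
    rw [← norm_iteratedDeriv_ofReal_comp (hIrC.of_le (by norm_num)) s, d2, hB₂]; exact b2 s hs
  have rI3 : ∀ s, C (k + s • w) → |iteratedDeriv 3 Ir s| ≤ B₃ := fun s hs => by
    rw [← norm_iteratedDeriv_ofReal_comp hIrC s, d3, hB₃]; exact b3 s hs
  -- far from the shell every jet of `Ir` vanishes (locally `Ir ≡ 0`)
  have hfar : ∀ s, ¬ |el s| ≤ klScale e₀ n + P₀ → ∀ j ≤ 3, iteratedDeriv j Ir s = 0 := by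
    intro s hs j _
    rw [not_le] at hs
    have hcont : Continuous el := helC.continuous
    have hopen : ∀ᶠ s' in 𝓝 s, klScale e₀ n + P₀ < |el s'| :=
      (continuous_abs.comp hcont).continuousAt.eventually (lt_mem_nhds hs)
    have hev : Ir =ᶠ[𝓝 s] fun _ => (0 : ℝ) := by
      filter_upwards [hopen] with s' hs'
      obtain ⟨z1, z2⟩ := profileIncr_jets_eq_zero_of_far he n k₀ (ν := νl) (e := el) bP₀ hs' 0
      rw [iteratedDeriv_zero] at z1 z2
      simp only [hIr, hGdef]
      have e2 : k₀ ^ 2 + (el s' - νl s') ^ 2 = k₀ ^ 2 + el s' ^ 2 + -(νl s' * (2 * el s' - νl s')) := by ring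
      rw [e2, z1, z2]; ring
    rw [(hev.iteratedDeriv j).eq_of_nhds, iteratedDeriv_const]
    simp
  -- the co-factor along the line and the localised Leibniz bounds
  set Ql : ℝ → ℝ := fun s => Q (k₀, k + s • w) with hQl
  have hQlC : ContDiff ℝ 3 Ql := hQ k₀ k
  have hB0 : 0 ≤ B₀ := (abs_nonneg _).trans (rI0 0)
  have hd0 : 0 ≤ d := (abs_nonneg _).trans (hd1 0)
  have hP1 : 0 ≤ P₁ := (abs_nonneg _).trans (hP₁ 0 0)
  have hP2 : 0 ≤ P₂ := (abs_nonneg _).trans (hP₂ 0 0)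
  have hP3 : 0 ≤ P₃ := (abs_nonneg _).trans (hP₃ 0 0)
  have hE00 : 0 ≤ E₀ := by rw [hE₀]; positivity
  have c1 : 0 ≤ C₁ := by rw [hC₁]; positivity
  have c2 : 0 ≤ C₂ := by rw [hC₂]; positivity
  have c3 : 0 ≤ C₃ := by rw [hC₃]; positivity
  have c4 : 0 ≤ C₄ := by rw [hC₄]; positivity
  have d1' : 0 ≤ D₁ := by rw [hD₁]; positivity
  have d2' : 0 ≤ D₂ := by rw [hD₂]; positivity
  have d3' : 0 ≤ D₃ := by rw [hD₃]; positivity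
  have w0 : 0 ≤ W₀ := by rw [hW₀]; positivity
  have w1 : 0 ≤ W₁ := by rw [hW₁]; positivity
  have w2 : 0 ≤ W₂ := by rw [hW₂]; positivity
  have w3 : 0 ≤ W₃ := by rw [hW₃]; positivity
  have hB1 : 0 ≤ B₁ := by rw [hB₁]; positivity
  have hB2 : 0 ≤ B₂ := by rw [hB₂]; positivity
  have hB3 : 0 ≤ B₃ := by rw [hB₃]; positivity
  have hQlfar : ∀ s, ¬ C (k + s • w) → ∀ j ≤ 3, iteratedDeriv j Ql s = 0 := fun s hs j hj => hQfar k₀ k s hs j hj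
  have hLeib := fun s (hs : ∀ i, |(k + s • w) i| ≤ π + zm) =>
    abs_iteratedDeriv_mul_le_of_local' hIrC hQlC (fun s => ∀ i, |(k + s • w) i| ≤ π + zm) (fun s => |el s| ≤ klScale e₀ n + P₀)
      (fun s => C (k + s • w))
      hB0 hB1 hB2 hB3 hq₀0 hq₁0 hq₂0 hq₃0 (fun s _ _ _ => rI0 s) (fun s _ _ hC => rI1 s hC) (fun s _ _ hC => rI2 s hC) (fun s _ _ hC => rI3 s hC)
      (fun s _ _ => hq₀ k₀ (k + s • w))
      (fun s hS hB => by have h := hq₁ k₀ k s hS hB; rwa [← iteratedDeriv_one] at h) (fun s hS hB => hq₂ k₀ k s hS hB)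
      (fun s hS hB => hq₃ k₀ k s hS hB) hfar hQlfar s hs
  -- the line restriction of the symbol
  have hline : (fun s : ℝ => Φ (((k₀, k) : ℝ × (Fin 2 → ℝ)) + s • (((0 : ℝ), w) : ℝ × (Fin 2 → ℝ)))) =
      fun s => (((Ir s * Ql s : ℝ)) : ℂ) := by
    funext s; rw [spaceLine_apply, hΦ]
  have hreal : ContDiff ℝ 3 fun s : ℝ => Ir s * Ql s := hIrC.mul hQlC
  have hC : ContDiff ℝ 3 fun s : ℝ => Φ (((k₀, k) : ℝ × (Fin 2 → ℝ)) + s • (((0 : ℝ), w) : ℝ × (Fin 2 → ℝ))) := by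
    rw [hline]; exact Complex.ofRealCLM.contDiff.comp hreal
  have hstep : (((0 : ℝ), w) : ℝ × (Fin 2 → ℝ)) = ((0 : ℝ), fun j => hx * (u j : ℝ)) := by rw [hw]
  have hsqr : ∀ s : ℝ, |s| ≤ 3 → ∀ i, |(k + s • w) i| ≤ π + zm := by
    intro s hs3 i
    have h1 : |k i| ≤ π := abs_sample_le_pi hxL q.2 i
    have h2 : |(s • w) i| ≤ zm := by
      rw [Pi.smul_apply, smul_eq_mul, abs_mul, hw]
      calc |s| * |hx * (u i : ℝ)| ≤ 3 * |hx * (u i : ℝ)| := mul_le_mul_of_nonneg_right hs3 (abs_nonneg _)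
        _ = 3 * |hx| * |(u i : ℝ)| := by rw [abs_mul]; ring
        _ ≤ zm := hu i
    calc |(k + s • w) i| = |k i + (s • w) i| := rfl
      _ ≤ |k i| + |(s • w) i| := abs_add_le _ _
      _ ≤ π + zm := add_le_add h1 h2
  -- the zone: `Φ(k₀, hₓ m) = 0` whenever `2|m_j| + 2N|u_j| ≥ L`, `N ≤ 3`
  have hL : (0 : ℝ) < L := Nat.cast_pos.2 (Nat.pos_of_ne_zero (NeZero.ne L))
  have hxL' : ∀ (N : ℕ), N ≤ 3 → ∀ (m : Fin 2 → ℤ) (j : Fin 2), (L : ℤ) ≤ 2 * |m j| + 2 * N * |u j| → π - zm ≤ |hx * (m j : ℝ)| := by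
    intro N hN m j hj
    have hN' : (N : ℝ) ≤ 3 := by exact_mod_cast hN
    have hj' : (L : ℝ) ≤ 2 * |(m j : ℝ)| + 2 * N * |(u j : ℝ)| := by
      have := hj; rw [← Int.cast_abs, ← Int.cast_abs]; exact_mod_cast this
    rw [abs_mul]
    have h1 : |hx| * L ≤ |hx| * (2 * |(m j : ℝ)| + 2 * N * |(u j : ℝ)|) := mul_le_mul_of_nonneg_left hj' (abs_nonneg _)
    have h2 := hu j
    have h3 : |hx| * (2 * N * |(u j : ℝ)|) ≤ 2 * zm := by
      have : 2 * N * |(u j : ℝ)| ≤ 2 * (3 * |(u j : ℝ)|) := by nlinarith [abs_nonneg (u j : ℝ)]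
      calc |hx| * (2 * N * |(u j : ℝ)|) ≤ |hx| * (2 * (3 * |(u j : ℝ)|)) := mul_le_mul_of_nonneg_left this (abs_nonneg _)
        _ = 2 * (3 * |hx| * |(u j : ℝ)|) := by ring
        _ ≤ 2 * zm := by linarith
    nlinarith [abs_nonneg hx, abs_nonneg (m j : ℝ), hxL]
  have hzone' : ∀ (N : ℕ), N ≤ 3 → ∀ (k₀ : ℝ) (m : Fin 2 → ℤ), (∃ j, (L : ℤ) ≤ 2 * |m j| + 2 * N * |u j|) →
      Φ (k₀, fun j => hx * (m j : ℝ)) = 0 := by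
    intro N hN k₀ m ⟨j, hj⟩
    exact hzoneΦ k₀ (fun j => hx * (m j : ℝ)) ⟨j, hxL' N hN m j hj⟩
  -- the pointwise bounds on `[0, N]`
  have hmain : ∀ (N : ℕ) (K : ℝ), N ≤ 3 → (∀ s, (∀ i, |(k + s • w) i| ≤ π + zm) → |iteratedDeriv N (fun s => Ir s * Ql s) s| ≤ K) →
      ∀ s ∈ Set.Icc (0 : ℝ) N, ‖iteratedDeriv N (fun s : ℝ =>
        Φ (((k₀, k) : ℝ × (Fin 2 → ℝ)) + s • (((0 : ℝ), w) : ℝ × (Fin 2 → ℝ)))) s‖ ≤ K := by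
    intro N K hN hK s hs
    have hN' : (N : ℝ) ≤ 3 := by exact_mod_cast hN
    have hs3 : |s| ≤ 3 := by rw [abs_of_nonneg hs.1]; exact hs.2.trans hN'
    rw [hline, norm_iteratedDeriv_ofReal_comp (hreal.of_le (by exact_mod_cast hN))]
    exact hK s (hsqr s hs3)
  refine ⟨?_, ?_, ?_⟩
  · have hm := hmain 1 (B₁ * q₀ + B₀ * q₁) (by norm_num) (fun s hs => (hLeib s hs).1)
    rw [hstep] at hC hm
    have h := norm_fwdDiff_iter_space_apply_le Φ a₀ h₀ hx 1 Gs hGs u (hzone' 1 (by norm_num)) q (hC.of_le (by norm_num)) hm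
    rwa [Function.iterate_one] at h
  · have hm := hmain 2 (B₂ * q₀ + 2 * (B₁ * q₁) + B₀ * q₂) (by norm_num) (fun s hs => (hLeib s hs).2.1)
    rw [hstep] at hC hm
    exact norm_fwdDiff_iter_space_apply_le Φ a₀ h₀ hx 2 Gs hGs u (hzone' 2 (by norm_num)) q (hC.of_le (by norm_num)) hm
  · have hm := hmain 3 (B₃ * q₀ + 3 * (B₂ * q₁) + 3 * (B₁ * q₂) + B₀ * q₃) le_rfl (fun s hs => (hLeib s hs).2.2)
    rw [hstep] at hC hm
    exact norm_fwdDiff_iter_space_apply_le Φ a₀ h₀ hx 3 Gs hGs u (hzone' 3 le_rfl) q hC hm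

end SampledLocal

end Summit.HubbardSuperconductivity.HubbardSuperconductivity.Theorems.TorusFourierL2

end
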